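import Literature.AlgebraicGeometry.Modules.PullbackUnitSections
import Literature.AlgebraicGeometry.Modules.DeterminantCocycle
import Literature.AlgebraicGeometry.Modules.UnitCocyclePullback
import Literature.AlgebraicGeometry.KTheory.PullbackVectorBundle
import Mathlib.LinearAlgebra.Matrix.NonsingularInverse
import HarnessLib

/-!
# The pulled-back frame of `f^*E` and naturality of the determinant class

For a morphism of schemes `f : X ⟶ Y`, an `𝒪_Y`-module `E` and a frame `e : 𝒪^I ≅ E|_U` with basis
sections `b_i`, the pull-backs `η(b_i) ∈ Γ(f^*E, f⁻¹U)` (`Modules/PullbackUnitSections.lean`) form a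
frame of `f^*E` over `f⁻¹U` (Hartshorne II.5, p. 110: "`f^*` of a locally free sheaf is locally free
of the same rank", with the same local bases):

* `pullbackFrame f e : 𝒪^I ≅ (f^*E)|_{f⁻¹U}` with `basisSection (pullbackFrame f e) i = η(b_i)`
  (`basisSection_pullbackFrame`). Construction: `f^*E` is abstractly free over `f⁻¹U` on `I` (the
  tree's `KTheory/PullbackVectorBundle`), say on `θ_j`; the dual sections `λ_i` of
  `exists_dualSection` give `θ_j = ∑_i λ_i(θ_j) η(b_i)` (`hom_ext_of_unitSection`), so the matrix of
  the `η(b_i)` in the `θ_j` is invertible and `θ_j ↦ η(b_j)` is an automorphism.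
* `transition_pullbackFrame` — **the transition matrices of pulled-back frames are the pulled-back
  transition matrices** `f^♯ T(e, e')` (because `η` is `f^♯`-semilinear);
* `FrameSystem.pullback`, `FrameSystem.pullback_cocycle_equiv` and
  `detClass_pullback : detClass (hE.pullback f) = CechPic.pullback f (detClass hE)` — **the
  determinant class commutes with pull-back** (Hartshorne II Ex. 6.8 (a)/(c): `f^*` on `Pic` and on
  `K` commute with `det`). Also `FrameSystem.pullback_rank`: ranks are preserved.

Everything is proved; no named facts.

## References

* R. Hartshorne, *Algebraic Geometry*, GTM 52 (1977), II.5 (p. 110), II Ex. 6.8. [Hartshorne1977]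
-/

noncomputable section

open CategoryTheory AlgebraicGeometry Opposite TopologicalSpace Limits

namespace Literature.AlgebraicGeometry.Modules

open Literature.AlgebraicGeometry.Motives

universe u

variable {X Y : Scheme.{u}} (f : X ⟶ Y) {E : Y.Modules} {U W : Y.Opens} {I I' : Type u}

/-! ### An abstract frame of `f^*E` over `f⁻¹U` -/

/-- If `E|_U` is free on `I` then `(f^*E)|_{f⁻¹U}` is free on `I` (abstractly: the tree's
`(f^*E)|_{f⁻¹U} ≅ (f ∣_ U)^*(E|_U) ≅ (f ∣_ U)^* 𝒪^I ≅ 𝒪^I`, `KTheory/PullbackVectorBundle.lean`).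
[folklore] -/
theorem nonempty_pullback_overIso (e : SheafOfModules.free I ≅ E.over U) :
    Nonempty (SheafOfModules.free I ≅ ((Scheme.Modules.pullback f).obj E).over (f ⁻¹ᵁ U)) := by
  obtain ⟨e'⟩ := KTheory.nonempty_restrictIso_of_overIso e
  obtain ⟨e₁⟩ := KTheory.nonempty_pullbackFreeIso (f ∣_ U) I
  obtain ⟨e₂⟩ := KTheory.nonempty_restrictPullbackIso f U E
  exact KTheory.nonempty_overIso_of_restrictIso
    (e₁.symm ≪≫ (Scheme.Modules.pullback (f ∣_ U)).mapIso e' ≪≫ e₂.symm)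

/-! ### The pulled-back frame -/

section Frame

variable (e : SheafOfModules.free I ≅ E.over U)

/-- A chosen abstract frame `θ` of `(f^*E)|_{f⁻¹U}`. [folklore] -/
def auxFrame : SheafOfModules.free I ≅ ((Scheme.Modules.pullback f).obj E).over (f ⁻¹ᵁ U) :=
  (nonempty_pullback_overIso f e).some

/-- The pulled-back basis sections `s_i = η(b_i) ∈ Γ(f^*E, f⁻¹U)`. [folklore] -/
def pulledSection (i : I) : Γ((Scheme.Modules.pullback f).obj E, f ⁻¹ᵁ U) :=
  unitSection f E U (basisSection e i)

/-- The endomorphism `θ_j ↦ s_j` of `(f^*E)|_{f⁻¹U}`. [folklore] -/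
def frameComparison :
    ((Scheme.Modules.pullback f).obj E).over (f ⁻¹ᵁ U) ⟶
      ((Scheme.Modules.pullback f).obj E).over (f ⁻¹ᵁ U) :=
  homOfBasisValues (auxFrame f e) (pulledSection f e)

/-- The matrix `A_{kj} = θ^*_k(s_j)` of the pulled-back sections in the abstract frame. [folklore] -/
def compMatrix : Matrix I I Γ(X, f ⁻¹ᵁ U) :=
  Matrix.of fun k j => coord (auxFrame f e) (𝟙 _) (pulledSection f e j) k

/-- The coordinate `λ_i(t) ∈ Γ(X, V)` of a section `t` of `f^*E` over `V ≤ f⁻¹U` with respect to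
the dual sections of the pulled-back frame. [folklore] -/
def pulledCoord {V : X.Opens} (k : V ⟶ f ⁻¹ᵁ U) (t : Γ((Scheme.Modules.pullback f).obj E, V))
    (i : I) : Γ(X, V) :=
  (appLE (dualSection f e i) k t : Γ(unitModule X, V))

/-- Unfolding `pulledCoord`. [folklore] -/
lemma pulledCoord_def {V : X.Opens} (k : V ⟶ f ⁻¹ᵁ U) (t : Γ((Scheme.Modules.pullback f).obj E, V))
    (i : I) : pulledCoord f e k t i = appLE (dualSection f e i) k t := rfl

/-- The matrix `B_{ij} = λ_i(θ_j)` of the abstract frame in the dual sections of the pulled-back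
sections. [folklore] -/
def invMatrix : Matrix I I Γ(X, f ⁻¹ᵁ U) :=
  Matrix.of fun i j => pulledCoord f e (𝟙 _) (basisSection (auxFrame f e) j) i

variable [Fintype I]

/-- `s_j = ∑_k A_{kj} θ_k`. [folklore] -/
lemma pulledSection_eq_sum (j : I) :
    pulledSection f e j = ∑ k, compMatrix f e k j • basisSection (auxFrame f e) k := by
  have h := eq_sum_coord_smul (auxFrame f e) (𝟙 _) (pulledSection f e j)
  simp only [presheaf_map_id] at h
  exact h

/-- **Generation**: every section `t` of `f^*E` over `V ≤ f⁻¹U` is `∑_i λ_i(t) s_i|_V` (the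
endomorphisms `𝟙` and `∑_i λ_i(–) s_i` agree on the `s_j`, hence are equal by
`hom_ext_of_unitSection`). [folklore] -/
theorem eq_sum_dualSection_smul {V : X.Opens} (k : V ⟶ f ⁻¹ᵁ U)
    (t : Γ((Scheme.Modules.pullback f).obj E, V)) :
    t = ∑ i, pulledCoord f e k t i •
      ((Scheme.Modules.pullback f).obj E).presheaf.map k.op (pulledSection f e i) := by
  classical
  have hg : (𝟙 (((Scheme.Modules.pullback f).obj E).over (f ⁻¹ᵁ U))) =
      ∑ i, dualSection f e i ≫ smulSection (pulledSection f e i) := by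
    refine hom_ext_of_unitSection e fun j => ?_
    change appLE (𝟙 _) (𝟙 _) (pulledSection f e j) = appLE (∑ i, _) (𝟙 _) (pulledSection f e j)
    rw [appLE_id, appLE_sum]
    simp_rw [appLE_comp, appLE_smulSection, presheaf_map_id]
    unfold pulledSection
    simp only [appLE_dualSection_unitSection, ite_smul, one_smul, zero_smul, Finset.sum_ite_eq,
      Finset.mem_univ, if_true]
  have hk := congrArg (fun g => appLE g k t) hg
  simp only [appLE_id, appLE_sum, appLE_comp, appLE_smulSection] at hk
  exact hk

/-- `θ_j = ∑_i B_{ij} s_i`. [folklore] -/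
theorem basisSection_auxFrame_eq_sum (j : I) :
    basisSection (auxFrame f e) j = ∑ i, invMatrix f e i j • pulledSection f e i := by
  have h := eq_sum_dualSection_smul f e (𝟙 _) (basisSection (auxFrame f e) j)
  simp only [presheaf_map_id] at h
  exact h

/-- `A B = 1`. [folklore] -/
theorem compMatrix_mul_invMatrix [DecidableEq I] : compMatrix f e * invMatrix f e = 1 := by
  ext k j
  have h := congrArg (fun t => coord (auxFrame f e) (𝟙 _) t k) (basisSection_auxFrame_eq_sum f e j)
  simp only [coord_basisSection, coord_sum, coord_smul] at h
  -- `h : δ_{jk} = ∑_i B_{ij} A_{ki}`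
  rw [Matrix.mul_apply, Matrix.one_apply]
  have h' : ∑ i, compMatrix f e k i * invMatrix f e i j =
      ∑ i, invMatrix f e i j * coord (auxFrame f e) (𝟙 _) (pulledSection f e i) k :=
    Finset.sum_congr rfl fun i _ => mul_comm _ _
  rw [h', ← h]
  by_cases hkj : k = j
  · subst hkj
    rw [if_pos rfl, if_pos rfl]
  · rw [if_neg hkj, if_neg (Ne.symm hkj)]

/-- `B A = 1`. [folklore] -/
theorem invMatrix_mul_compMatrix [DecidableEq I] : invMatrix f e * compMatrix f e = 1 :=
  mul_eq_one_comm.mp (compMatrix_mul_invMatrix f e)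

/-- The inverse endomorphism `θ_j ↦ ∑_i B_{ij} θ_i`. [folklore] -/
def frameComparisonInv :
    ((Scheme.Modules.pullback f).obj E).over (f ⁻¹ᵁ U) ⟶
      ((Scheme.Modules.pullback f).obj E).over (f ⁻¹ᵁ U) :=
  homOfBasisValues (auxFrame f e) fun j => ∑ i, invMatrix f e i j • basisSection (auxFrame f e) i

/-- `frameComparisonInv ≫ frameComparison = 𝟙` (this is the generation identity). [folklore] -/
lemma frameComparisonInv_comp : frameComparisonInv f e ≫ frameComparison f e = 𝟙 _ := by
  refine hom_ext_of_basisSection (auxFrame f e) fun j => ?_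
  rw [appLE_comp, frameComparisonInv, appLE_homOfBasisValues, appLE_id, appLE_sum_right]
  simp_rw [appLE_smul_right, frameComparison, appLE_homOfBasisValues]
  exact (basisSection_auxFrame_eq_sum f e j).symm

/-- `frameComparison ≫ frameComparisonInv = 𝟙` (from `B A = 1`). [folklore] -/
lemma frameComparison_comp_inv : frameComparison f e ≫ frameComparisonInv f e = 𝟙 _ := by
  classical
  refine hom_ext_of_basisSection (auxFrame f e) fun j => ?_
  rw [appLE_comp, frameComparison, appLE_homOfBasisValues, appLE_id, pulledSection_eq_sum,
    appLE_sum_right]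
  simp_rw [appLE_smul_right, frameComparisonInv, appLE_homOfBasisValues, Finset.smul_sum, smul_smul]
  rw [Finset.sum_comm]
  simp_rw [← Finset.sum_smul]
  have h : ∀ i, (∑ k, compMatrix f e k j * invMatrix f e i k) = (invMatrix f e * compMatrix f e) i j :=
    fun i => by
      rw [Matrix.mul_apply]
      exact Finset.sum_congr rfl fun k _ => mul_comm _ _
  simp_rw [h, invMatrix_mul_compMatrix, Matrix.one_apply, ite_smul, one_smul, zero_smul,
    Finset.sum_ite_eq', Finset.mem_univ, if_true]

/-- `θ_j ↦ s_j` is an automorphism. [folklore] -/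
theorem isIso_frameComparison : IsIso (frameComparison f e) :=
  ⟨⟨frameComparisonInv f e, frameComparison_comp_inv f e, frameComparisonInv_comp f e⟩⟩

/-- **The pulled-back frame `𝒪^I ≅ (f^*E)|_{f⁻¹U}`** on the sections `η(b_i)` (Hartshorne II.5,
p. 110). [cite: Hartshorne1977, II.5 (p. 110)] -/
def pullbackFrame : SheafOfModules.free I ≅ ((Scheme.Modules.pullback f).obj E).over (f ⁻¹ᵁ U) :=
  auxFrame f e ≪≫ @asIso _ _ _ _ (frameComparison f e) (isIso_frameComparison f e)

/-- **The basis sections of the pulled-back frame are the pulled-back basis sections.**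
[folklore] -/
theorem basisSection_pullbackFrame (i : I) :
    basisSection (E := (Scheme.Modules.pullback f).obj E) (pullbackFrame f e) i =
      unitSection f E U (basisSection e i) := by
  rw [basisSection, pullbackFrame, Iso.trans_hom, SheafOfModules.freeHomEquiv_comp_apply,
    overSectionsEquiv_sectionsMap', asIso_hom]
  change appLE (frameComparison f e) (𝟙 _) (basisSection (auxFrame f e) i) = _
  rw [frameComparison, appLE_homOfBasisValues]
  rfl

end Frame

/-! ### Transition matrices of pulled-back frames -/

section Transition

variable (e : SheafOfModules.free I ≅ E.over U) (e' : SheafOfModules.free I' ≅ E.over W)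
  [Fintype I] [Fintype I']

/-- **`T(f^*e, f^*e') = f^♯ T(e, e')`**: over `V ≤ f⁻¹(U ⊓ W)` the transition matrix of the
pulled-back frames is the pull-back of the transition matrix over `U ⊓ W`. [folklore] -/
theorem transition_pullbackFrame {V : X.Opens} (l : V ≤ f ⁻¹ᵁ (U ⊓ W)) (k : V ⟶ f ⁻¹ᵁ U)
    (k' : V ⟶ f ⁻¹ᵁ W) :
    transition (pullbackFrame f e) (pullbackFrame f e') k k' =
      (transition e e' (homOfLE inf_le_left) (homOfLE inf_le_right)).map (f.appLE (U ⊓ W) V l).hom := by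
  ext i j
  have key : ((Scheme.Modules.pullback f).obj E).presheaf.map k'.op
      (basisSection (E := (Scheme.Modules.pullback f).obj E) (pullbackFrame f e') j) =
      ∑ i, f.appLE (U ⊓ W) V l (transition e e' (homOfLE inf_le_left) (homOfLE inf_le_right) i j) •
        ((Scheme.Modules.pullback f).obj E).presheaf.map k.op
          (basisSection (E := (Scheme.Modules.pullback f).obj E) (pullbackFrame f e) i) := by
    rw [basisSection_pullbackFrame,
      Subsingleton.elim k' (homOfLE l ≫ (Opens.map f.base).map (homOfLE inf_le_right)), op_comp,
      Functor.map_comp]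
    change ((Scheme.Modules.pullback f).obj E).presheaf.map (homOfLE l).op
      (((Scheme.Modules.pullback f).obj E).presheaf.map
        ((Opens.map f.base).map (homOfLE (inf_le_right : U ⊓ W ≤ W))).op
        (unitSection f E W (basisSection e' j))) = _
    rw [← unitSection_map, map_basisSection_eq_sum_transition e e' (homOfLE inf_le_left)
      (homOfLE inf_le_right) j, unitSection_sum, map_sum]
    refine Finset.sum_congr rfl fun i _ => ?_
    rw [unitSection_smul, Scheme.Modules.map_smul, unitSection_map, presheaf_map_map,
      basisSection_pullbackFrame,
      Subsingleton.elim k (homOfLE l ≫ (Opens.map f.base).map (homOfLE inf_le_left)),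
      ← presheaf_map_map]
    rfl
  rw [transition_apply, key, coord_sum_smul_basisSection, Matrix.map_apply]

/-- Determinants of transition matrices of pulled-back frames. [folklore] -/
theorem transitionDet_pullbackFrame {n n' : ℕ} (ε : I ≃ Fin n) (ε' : I' ≃ Fin n') {V : X.Opens}
    (l : V ≤ f ⁻¹ᵁ (U ⊓ W)) (k : V ⟶ f ⁻¹ᵁ U) (k' : V ⟶ f ⁻¹ᵁ W) :
    transitionDet (pullbackFrame f e) (pullbackFrame f e') ε ε' k k' =
      f.appLE (U ⊓ W) V l (transitionDet e e' ε ε' (homOfLE inf_le_left) (homOfLE inf_le_right)) := by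
  unfold transitionDet
  split_ifs with h
  · subst h
    change _ = (f.appLE (U ⊓ W) V l).hom _
    rw [RingHom.map_det, RingHom.mapMatrix_apply]
    congr 1
    ext a b
    simp only [Matrix.map_apply, Matrix.of_apply, stdTransition_apply, transition_pullbackFrame f e e' l,
      Fin.cast_eq_self]
  · exact (map_one (f.appLE (U ⊓ W) V l).hom).symm

end Transition

/-! ### Pull-back of frame systems and naturality of the determinant class -/

section Naturality

open scoped Classical

variable (F : FrameSystem E)

/-- **The pulled-back frame system** of `f^*E`: `U_x := f⁻¹U_{f x}` with the pulled-back frame.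
[folklore] -/
def FrameSystem.pullback : FrameSystem ((Scheme.Modules.pullback f).obj E) where
  U x := f ⁻¹ᵁ F.U (f.base x)
  mem x := F.mem (f.base x)
  I x := F.I (f.base x)
  rank x := F.rank (f.base x)
  enum x := F.enum (f.base x)
  frame x :=
    haveI : Fintype (F.I (f.base x)) := Fintype.ofEquiv _ (F.enum (f.base x)).symm
    pullbackFrame f (F.frame (f.base x))

/-- The pulled-back frame system has the same ranks. [folklore] -/
lemma FrameSystem.pullback_rank (x : X) : (F.pullback f).rank x = F.rank (f.base x) := rfl

/-- **The determinant cocycle of the pulled-back frame system is the pulled-back determinant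
cocycle** (up to the trivial coboundary). [folklore] -/
theorem FrameSystem.pullback_cocycle_equiv :
    UnitCocycle.Equiv (F.pullback f).cocycle (UnitCocycle.pullback f F.cocycle) := by
  refine UnitCocycle.equiv_of_eq _ _ (fun x => f ⁻¹ᵁ F.U (f.base x)) (fun x => F.mem (f.base x))
    (fun x => le_rfl) (fun x => le_rfl) fun x y V hx hy => ?_
  haveI : Fintype (F.I (f.base x)) := Fintype.ofEquiv _ (F.enum (f.base x)).symm
  haveI : Fintype (F.I (f.base y)) := Fintype.ofEquiv _ (F.enum (f.base y)).symm
  exact (transitionDet_pullbackFrame f (F.frame (f.base x)) (F.frame (f.base y)) (F.enum (f.base x))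
    (F.enum (f.base y)) (UnitCocycle.le_preimage_inf f hx hy) (homOfLE hx) (homOfLE hy)).symm

/-- **The determinant class commutes with pull-back**: `[det f^*E] = f^*[det E]` in `Ȟ¹(X, 𝒪_X^×)`
(Hartshorne II Ex. 6.8). [cite: Hartshorne1977, II Ex. 6.8] -/
theorem detClass_pullback (hE : IsFiniteLocallyFree E) :
    detClass (hE.pullback f) = CechPic.pullback f (detClass hE) := by
  rw [detClass_eq_mk (hE.pullback f) ((frameSystemOfIsFiniteLocallyFree hE).pullback f), detClass,
    CechPic.pullback_mk]
  exact CechPic.sound ((frameSystemOfIsFiniteLocallyFree hE).pullback_cocycle_equiv f)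

end Naturality

end Literature.AlgebraicGeometry.Modules

end
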